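import Summits.BirchSwinnertonDyer.BirchSwinnertonDyer.Theorems.Rank2Observatory2DescClFieldCert
import HarnessLib

/-!
# BirchSwinnertonDyer — rank ≥ 2 observatory: KERNEL-2DESC-CL v2.0 — the `T`-unit family entries and their certificates

HONEST FRAMING: per-curve certified theorems and census instruments; no claim on BSD in rank ≥ 2.

Fourth generic file of the reflective reshape of the class-group-general kernel 2-descent (cell `b2b-bsdr2`,
seat cert-1; design `b2b-bsdr2-cert-1/KERNEL-2DESC-CL.md` §7).  For a checked field record `fc : ClFieldCert`
(file 3) realised in `K = ℚ(α)`, this file provides the height-one primes `W₁`, `W₂` above the auxiliary prime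
`q` as terms, the registry-row lookup `fc.row p`, and the **family entries** of the `T`-unit family of a
curve: `FamEntry = kind × code × ElemEntry` with `kind = 0` unit, `1` the element `q`, `2` registry element
`g_P` (`(g_P) = P·W₁^e`, own code `P`), `3` the element `γ` (`(γ) = W₁^k`).  `famCheck fc D f : Bool`
verifies one entry against the field record and the element `D = F′(θ_E)` of the curve; the soundness lemmas
deliver exactly what the per-curve theorem (file 5) feeds to the generic cover-set machinery: `g ≠ 0`
(`lin_ne_zero_of_famCheck`), support `⊆ supp(D·q)` (`supp_of_famCheck`), the integers
`log ord_{W₁}(g)`, `log ord_{W₂}(g)` (`log_W₁_of_famCheck`, `log_W₂_of_famCheck`, via p312739/p311447), the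
real sign bit, the norm, and the residue-character non-divisibility.

Sorry-free; axioms `propext`, `Classical.choice`, `Quot.sound`.
[cite: Cohen1993, §4.8.2, §6.5] [cite: Marcus2018, Ch. 3, Thm. 22; Ch. 5, Thm. 38] [cite: Cassels1991LecturesEllipticCurves, §15]
-/

set_option linter.dupNamespace false

noncomputable section

open scoped Classical NumberField nonZeroDivisors

open Literature.NumberTheory.NumberFields Polynomial Module NumberField IsDedekindDomain Ideal

namespace Summit.BirchSwinnertonDyer.BirchSwinnertonDyer.Rank2Observatory.TwoDescCl

open TwoDescCubic

/-! ## Computable data: row lookup, order check, family entries -/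

namespace ClFieldCert

variable (fc : ClFieldCert)

/-- The registry row of the rational prime `p` (a junk inert row if absent; `famCheck` certifies presence). -/
def row (p : ℕ) : PrimeEntry := (fc.primes.find? fun e => e.p == p).getD ⟨p, 2, (0, 0, 0), (0, 0, 0), [], []⟩

end ClFieldCert

/-- `N = q^e · m` with `q ∤ m`. Computable. [folklore] -/
def ordCheck (q N e : ℕ) : Bool := decide (N = q ^ e * (N / q ^ e) ∧ ¬ q ∣ N / q ^ e)

/-- A family entry: `(kind, code, element)`; `kind = 0` unit, `1` the element `q`, `2` registry element with
own code, `3` the element `γ`. -/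
abbrev FamEntry := ℕ × PCode × ElemEntry

/-- The kind-specific part of the entry check. Computable. [cite: Cohen1993, §6.5] -/
def famKindCheck (fc : ClFieldCert) (D : ℤ × ℤ × ℤ) (f : FamEntry) : Bool :=
  if f.1 = 0 then unitCert fc.a fc.b fc.c f.2.2.g f.2.2.δ
  else if f.1 = 1 then decide (f.2.2.g = ((fc.q : ℤ), 0, 0))
  else if f.1 = 2 then
    (fc.primes.any fun e => e.p == f.2.1.1) && decide (f.2.1 ∈ (fc.row f.2.1.1).codes) &&
      memCode f.2.1 D && prodPowCert fc.a fc.b fc.c f.2.2.g f.2.2.δ (f.2.1.1 * fc.q) f.2.2.k &&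
      invCert fc.a fc.b fc.c fc.w₂ f.2.2.g f.2.2.inv2 &&
      ordCheck fc.q (normFormZ fc.a fc.b fc.c f.2.2.g.1 f.2.2.g.2.1 f.2.2.g.2.2).natAbs f.2.2.e &&
      ((fc.row f.2.1.1).codes.all fun C' =>
        C' == f.2.1 || f.2.2.invs.any fun y => invCert fc.a fc.b fc.c C' f.2.2.g y)
  else if f.1 = 3 then
    prodPowCert fc.a fc.b fc.c f.2.2.g f.2.2.δ (1 * fc.q) f.2.2.k &&
      invCert fc.a fc.b fc.c fc.w₂ f.2.2.g f.2.2.inv2 &&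
      ordCheck fc.q (normFormZ fc.a fc.b fc.c f.2.2.g.1 f.2.2.g.2.1 f.2.2.g.2.2).natAbs f.2.2.e
  else false

/-- **The family-entry check**: sign test, non-zero norm, residue-character non-divisibility, and the
kind-specific certificates. Computable. [cite: Cassels1991LecturesEllipticCurves, §15] -/
def famCheck (fc : ClFieldCert) (D : ℤ × ℤ × ℤ) (f : FamEntry) : Bool :=
  signCond fc.lo fc.hi f.2.2.g f.2.2.sg &&
    decide (normFormZ fc.a fc.b fc.c f.2.2.g.1 f.2.2.g.2.1 f.2.2.g.2.2 ≠ 0) &&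
    (fc.chars.all fun ch => !decide ((ch.1 : ℤ) ∣ evalInt ch.2.1 f.2.2.g)) && famKindCheck fc D f

/-- `log ord_{W₁}` of an entry: `0` (unit), `-1` (`q`), `-e` (kinds `2`, `3`). -/
def famL₁ (f : FamEntry) : ℤ := if f.1 = 0 then 0 else if f.1 = 1 then -1 else -(f.2.2.e : ℤ)

/-- `log ord_{W₂}` of an entry: `-1` for `q`, else `0`. -/
def famL₂ (f : FamEntry) : ℤ := if f.1 = 1 then -1 else 0

/-! ## Soundness -/

variable {K : Type*} [Field K] [NumberField K] {θ : K} (fc : ClFieldCert)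

namespace ClFieldCert

/-- The code of `W₁` is a code of the row of `q`. [folklore] -/
theorem w₁_mem_codes : fc.w₁ ∈ fc.qEntry.codes := by rw [qEntry_codes]; simp

/-- The code of `W₂` is a code of the row of `q`. [folklore] -/
theorem w₂_mem_codes : fc.w₂ ∈ fc.qEntry.codes := by rw [qEntry_codes]; simp

/-- **`W₁`** as a height-one prime. -/
def W₁ (hθ : aeval θ (MonicCubic.poly fc.a fc.b fc.c) = 0) (h3 : finrank ℚ K = 3) (hF : fc.check = true)
    (hpr : fc.primeList.Forall Nat.Prime) : HeightOneSpectrum (𝓞 K) :=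
  primeOfCode (fc.irreducible_of_check hF) hθ h3 (e := fc.qEntry) (fc.q_prime hpr) (fc.qEntry_check hF)
    fc.w₁_mem_codes

/-- **`W₂`** as a height-one prime. -/
def W₂ (hθ : aeval θ (MonicCubic.poly fc.a fc.b fc.c) = 0) (h3 : finrank ℚ K = 3) (hF : fc.check = true)
    (hpr : fc.primeList.Forall Nat.Prime) : HeightOneSpectrum (𝓞 K) :=
  primeOfCode (fc.irreducible_of_check hF) hθ h3 (e := fc.qEntry) (fc.q_prime hpr) (fc.qEntry_check hF)
    fc.w₂_mem_codes

variable {fc}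

section W
variable (hθ : aeval θ (MonicCubic.poly fc.a fc.b fc.c) = 0) (h3 : finrank ℚ K = 3) (hF : fc.check = true)
  (hpr : fc.primeList.Forall Nat.Prime)

/-- `W₁` is presented by its code. [folklore] -/
theorem W₁_asIdeal : (fc.W₁ hθ h3 hF hpr).asIdeal = idealOf hθ fc.w₁ := rfl

/-- `W₂` is presented by its code. [folklore] -/
theorem W₂_asIdeal : (fc.W₂ hθ h3 hF hpr).asIdeal = idealOf hθ fc.w₂ := rfl

/-- `W₁ ≠ W₂`. [folklore] -/
theorem W₁_ne_W₂ : fc.W₁ hθ h3 hF hpr ≠ fc.W₂ hθ h3 hF hpr := fun h =>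
  fc.w₁_ne_w₂ hθ h3 hF hpr (congrArg HeightOneSpectrum.asIdeal h)

/-- `N(W₁) = q`. [cite: Cohen1993, §4.8.2, Thm. 4.8.13] -/
theorem absNorm_W₁ : absNorm (fc.W₁ hθ h3 hF hpr).asIdeal = fc.q := (fc.w₁_of_check hθ h3 hF hpr).2

/-- `N(W₂) = q²`. [cite: Cohen1993, §4.8.2, Thm. 4.8.13] -/
theorem absNorm_W₂ : absNorm (fc.W₂ hθ h3 hF hpr).asIdeal = fc.q ^ 2 := (fc.w₂_of_check hθ h3 hF hpr).2

/-- `q ∈ W₁`. [folklore] -/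
theorem q_mem_W₁ : ((fc.q : ℕ) : 𝓞 K) ∈ (fc.W₁ hθ h3 hF hpr).asIdeal :=
  natCast_mem_idealOf hθ (e := fc.qEntry) fc.w₁_mem_codes

/-- `q ∈ W₂`. [folklore] -/
theorem q_mem_W₂ : ((fc.q : ℕ) : 𝓞 K) ∈ (fc.W₂ hθ h3 hF hpr).asIdeal :=
  natCast_mem_idealOf hθ (e := fc.qEntry) fc.w₂_mem_codes

/-- Every height-one prime containing `q` is `W₁` or `W₂`. [cite: Cohen1993, §4.8.2, Thm. 4.8.13] -/
theorem eq_W₁_or_W₂ (u : HeightOneSpectrum (𝓞 K)) (hu : ((fc.q : ℕ) : 𝓞 K) ∈ u.asIdeal) :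
    u = fc.W₁ hθ h3 hF hpr ∨ u = fc.W₂ hθ h3 hF hpr := by
  rcases fc.qcover_of_check hθ h3 hF hpr u.asIdeal u.isPrime hu with h | h
  · exact Or.inl (HeightOneSpectrum.ext h)
  · exact Or.inr (HeightOneSpectrum.ext h)

end W

/-- A present registry row: `fc.row p ∈ fc.primes` with `(fc.row p).p = p`. [folklore] -/
theorem row_mem {p : ℕ} (h : (fc.primes.any fun e => e.p == p) = true) :
    fc.row p ∈ fc.primes ∧ (fc.row p).p = p := by
  unfold row
  cases hfind : fc.primes.find? (fun e => e.p == p) with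
  | none =>
    exfalso
    rw [List.find?_eq_none] at hfind
    obtain ⟨e, he, hep⟩ := List.any_eq_true.mp h
    exact absurd hep (by simpa using hfind e he)
  | some e =>
    simp only [Option.getD_some]
    exact ⟨List.mem_of_find?_eq_some hfind, by simpa using List.find?_some hfind⟩

end ClFieldCert

open ClFieldCert

variable {fc} {D : ℤ × ℤ × ℤ} {f : FamEntry}

/-- The common clauses of a checked entry. -/
theorem common_of_famCheck (h : famCheck fc D f = true) :
    signCond fc.lo fc.hi f.2.2.g f.2.2.sg = true ∧
      normFormZ fc.a fc.b fc.c f.2.2.g.1 f.2.2.g.2.1 f.2.2.g.2.2 ≠ 0 ∧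
      (∀ ch ∈ fc.chars, ¬ (ch.1 : ℤ) ∣ evalInt ch.2.1 f.2.2.g) ∧ famKindCheck fc D f = true := by
  simp only [famCheck, Bool.and_eq_true, decide_eq_true_eq, List.all_eq_true, Bool.not_eq_true',
    decide_eq_false_iff_not] at h
  exact ⟨h.1.1.1, h.1.1.2, h.1.2, h.2⟩

/-- The entry is non-zero. [folklore] -/
theorem lin_ne_zero_of_famCheck (hθ : aeval θ (MonicCubic.poly fc.a fc.b fc.c) = 0) (h3 : finrank ℚ K = 3)
    (hF : fc.check = true) (h : famCheck fc D f = true) :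
    (lin hθ f.2.2.g.1 f.2.2.g.2.1 f.2.2.g.2.2 : 𝓞 K) ≠ 0 :=
  lin_ne_zero_of_coords (fc.irreducible_of_check hF) hθ h3 _ (common_of_famCheck h).2.1

/-- The norm of the entry. [cite: Marcus2018, Ch. 2, Thm. 4] -/
theorem norm_of_famCheck (hθ : aeval θ (MonicCubic.poly fc.a fc.b fc.c) = 0) (h3 : finrank ℚ K = 3)
    (hF : fc.check = true) :
    Algebra.norm ℚ ((lin hθ f.2.2.g.1 f.2.2.g.2.1 f.2.2.g.2.2 : 𝓞 K) : K) =
      ((normFormZ fc.a fc.b fc.c f.2.2.g.1 f.2.2.g.2.1 f.2.2.g.2.2 : ℤ) : ℚ) :=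
  norm_lin_coords (fc.irreducible_of_check hF) hθ h3 _

/-- The sign bit. [cite: Cassels1991LecturesEllipticCurves, §15] -/
theorem sign_iff_of_famCheck (hθ : aeval θ (MonicCubic.poly fc.a fc.b fc.c) = 0) (ρ : K →+* ℝ)
    (hlo : ((fc.lo : ℚ) : ℝ) < ρ θ) (hhi : ρ θ < ((fc.hi : ℚ) : ℝ)) (hF : fc.check = true)
    (h : famCheck fc D f = true) :
    (f.2.2.sg = true ↔ ρ ((lin hθ f.2.2.g.1 f.2.2.g.2.1 f.2.2.g.2.2 : 𝓞 K) : K) < 0) :=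
  sign_iff_of_signCond hθ ρ (fc.interval_of_check hF).1 hlo hhi (common_of_famCheck h).1

/-- The entry is non-zero at the real place. -/
theorem rho_ne_zero_of_famCheck (hθ : aeval θ (MonicCubic.poly fc.a fc.b fc.c) = 0) (ρ : K →+* ℝ)
    (hlo : ((fc.lo : ℚ) : ℝ) < ρ θ) (hhi : ρ θ < ((fc.hi : ℚ) : ℝ)) (hF : fc.check = true)
    (h : famCheck fc D f = true) :
    ρ ((lin hθ f.2.2.g.1 f.2.2.g.2.1 f.2.2.g.2.2 : 𝓞 K) : K) ≠ 0 :=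
  rho_lin_ne_zero_of_signCond hθ ρ (fc.interval_of_check hF).1 hlo hhi (common_of_famCheck h).1

/-- Residue characters do not vanish on the entry. -/
theorem not_dvd_evalInt_of_famCheck (h : famCheck fc D f = true) {ch : ℕ × ℤ × ℤ} (hch : ch ∈ fc.chars) :
    ¬ (ch.1 : ℤ) ∣ evalInt ch.2.1 f.2.2.g :=
  (common_of_famCheck h).2.2.1 ch hch

omit [NumberField K] in
/-- The element `q` on the power basis. -/
theorem lin_q (hθ : aeval θ (MonicCubic.poly fc.a fc.b fc.c) = 0) :
    (lin hθ (fc.q : ℤ) 0 0 : 𝓞 K) = ((fc.q : ℕ) : 𝓞 K) := by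
  simp [lin]

/-- **Support**: every prime containing the entry contains `M = D·q`. [cite: Marcus2018, Ch. 3, Thm. 22] -/
theorem supp_of_famCheck (hθ : aeval θ (MonicCubic.poly fc.a fc.b fc.c) = 0) (h3 : finrank ℚ K = 3)
    (hF : fc.check = true) (hpr : fc.primeList.Forall Nat.Prime) (h : famCheck fc D f = true)
    (v : HeightOneSpectrum (𝓞 K)) (hv : (lin hθ f.2.2.g.1 f.2.2.g.2.1 f.2.2.g.2.2 : 𝓞 K) ∈ v.asIdeal) :
    (lin hθ D.1 D.2.1 D.2.2 : 𝓞 K) * ((fc.q : ℕ) : 𝓞 K) ∈ v.asIdeal := by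
  have hirr := fc.irreducible_of_check hF
  have hk := (common_of_famCheck h).2.2.2
  unfold famKindCheck at hk
  split_ifs at hk with h0 h1 h2 h3'
  · exact absurd hv (not_mem_of_unitCert hθ hk v)
  · rw [decide_eq_true_eq] at hk
    rw [hk] at hv
    simp only at hv
    rw [lin_q hθ] at hv
    exact Ideal.mul_mem_left _ _ hv
  · simp only [Bool.and_eq_true, decide_eq_true_eq, List.all_eq_true, Bool.or_eq_true, beq_iff_eq,
      List.any_eq_true] at hk
    obtain ⟨⟨⟨⟨⟨⟨hany, hC⟩, hmem⟩, hpp⟩, -⟩, -⟩, hinvs⟩ := hk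
    obtain ⟨hrow, hrowp⟩ := row_mem (fc := fc) (by simpa [List.any_eq_true] using hany)
    rcases natCast_mem_or_of_prodPowCert hθ hpp v hv with hp | hq
    · have hp' : ((fc.row f.2.1.1).p : 𝓞 K) ∈ v.asIdeal := by rw [hrowp]; exact hp
      obtain ⟨C', hC', hv'⟩ := exists_code_of_natCast_mem hirr hθ h3 (fc.prime_of_mem hpr hrow)
        (fc.row_check_of_mem hF hrow).1 v hp'
      rcases hinvs C' hC' with rfl | ⟨y, -, hy⟩
      · exact Ideal.mul_mem_right _ _ (lin_mem_of_memCode hθ v hv' D hmem)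
      · exact absurd hv (lin_not_mem_of_invCert hθ v hv' hy)
    · exact Ideal.mul_mem_left _ _ hq
  · simp only [Bool.and_eq_true] at hk
    rcases natCast_mem_or_of_prodPowCert hθ hk.1.1 v hv with h1' | hq
    · exact absurd (v.isPrime.ne_top ((Ideal.eq_top_iff_one _).mpr (by simpa using h1'))) id
    · exact Ideal.mul_mem_left _ _ hq

/-- `|N(g)| = q^e · m`, `q ∤ m`, from `ordCheck`. [folklore] -/
theorem natAbs_norm_of_ordCheck (hθ : aeval θ (MonicCubic.poly fc.a fc.b fc.c) = 0) (h3 : finrank ℚ K = 3)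
    (hF : fc.check = true) {g : ℤ × ℤ × ℤ} {e : ℕ}
    (h : ordCheck fc.q (normFormZ fc.a fc.b fc.c g.1 g.2.1 g.2.2).natAbs e = true) :
    (Algebra.norm ℤ (lin hθ g.1 g.2.1 g.2.2 : 𝓞 K)).natAbs =
        fc.q ^ e * ((normFormZ fc.a fc.b fc.c g.1 g.2.1 g.2.2).natAbs / fc.q ^ e) ∧
      ¬ fc.q ∣ (normFormZ fc.a fc.b fc.c g.1 g.2.1 g.2.2).natAbs / fc.q ^ e := by
  simp only [ordCheck, decide_eq_true_eq] at h
  rw [natAbs_norm_lin_coords (fc.irreducible_of_check hF) hθ h3]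
  exact h

/-- **`log ord_{W₁}` of the entry.** [cite: Marcus2018, Ch. 3, Thm. 22] -/
theorem log_W₁_of_famCheck (hθ : aeval θ (MonicCubic.poly fc.a fc.b fc.c) = 0) (h3 : finrank ℚ K = 3)
    (hF : fc.check = true) (hpr : fc.primeList.Forall Nat.Prime) (h : famCheck fc D f = true) :
    WithZero.log ((fc.W₁ hθ h3 hF hpr).valuation K ((lin hθ f.2.2.g.1 f.2.2.g.2.1 f.2.2.g.2.2 : 𝓞 K) : K)) =
      famL₁ f := by
  have hq := fc.q_prime hpr
  have hk := (common_of_famCheck h).2.2.2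
  unfold famKindCheck at hk
  unfold famL₁
  -- the generic `(−e, 0)` computation for kinds `2` and `3`
  have gen : invCert fc.a fc.b fc.c fc.w₂ f.2.2.g f.2.2.inv2 = true →
      ordCheck fc.q (normFormZ fc.a fc.b fc.c f.2.2.g.1 f.2.2.g.2.1 f.2.2.g.2.2).natAbs f.2.2.e = true →
      WithZero.log ((fc.W₁ hθ h3 hF hpr).valuation K
        ((lin hθ f.2.2.g.1 f.2.2.g.2.1 f.2.2.g.2.2 : 𝓞 K) : K)) = -(f.2.2.e : ℤ) := by
    intro hinv hord
    obtain ⟨hN, hm⟩ := natAbs_norm_of_ordCheck hθ h3 hF hord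
    refine log_valuation_eq_of_forall_not_mem hq ({fc.W₁ hθ h3 hF hpr, fc.W₂ hθ h3 hF hpr} : Finset _)
      (fun u hu => by
        rcases eq_W₁_or_W₂ hθ h3 hF hpr u hu with h | h <;> simp [h])
      (fun u => if u = fc.W₁ hθ h3 hF hpr then 1 else 2) (fun u hu => ?_) (by simp) (by simp) ?_ ?_ hm
    · simp only [Finset.mem_insert, Finset.mem_singleton] at hu
      rcases hu with rfl | rfl
      · simp [absNorm_W₁]
      · rw [if_neg (W₁_ne_W₂ hθ h3 hF hpr).symm]; exact absNorm_W₂ hθ h3 hF hpr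
    · intro u hu hne
      simp only [Finset.mem_insert, Finset.mem_singleton] at hu
      rcases hu with rfl | rfl
      · exact absurd rfl hne
      · exact lin_not_mem_of_invCert hθ _ (W₂_asIdeal hθ h3 hF hpr) hinv
    · simpa using hN
  split_ifs at hk ⊢ with h0 h1 h2 h3'
  · exact log_valuation_eq_zero_of_unitCert hθ hk _
  · rw [decide_eq_true_eq] at hk
    rw [hk]
    simp only
    rw [lin_q hθ]
    have hN : (Algebra.norm ℤ ((fc.q : ℕ) : 𝓞 K)).natAbs = fc.q ^ 3 * 1 := by
      have e := natAbs_norm_lin_coords (fc.irreducible_of_check hF) hθ h3 ((fc.q : ℤ), 0, 0)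
      simp only at e
      rw [lin_q hθ] at e
      rw [e]
      simp [normFormZ, Int.natAbs_pow]
    have hm : ¬ fc.q ∣ 1 := fun hd => hq.one_lt.ne' (Nat.dvd_one.mp hd)
    exact (log_valuation_eq_neg_one_of_one_two hq (W₁_ne_W₂ hθ h3 hF hpr) (eq_W₁_or_W₂ hθ h3 hF hpr)
      (absNorm_W₁ hθ h3 hF hpr) (absNorm_W₂ hθ h3 hF hpr) (q_mem_W₁ hθ h3 hF hpr) (q_mem_W₂ hθ h3 hF hpr)
      hN hm).1
  · simp only [Bool.and_eq_true] at hk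
    exact gen hk.1.1.2 hk.1.2
  · simp only [Bool.and_eq_true] at hk
    exact gen hk.1.2 hk.2

/-- **`log ord_{W₂}` of the entry.** [cite: Marcus2018, Ch. 3, Thm. 22] -/
theorem log_W₂_of_famCheck (hθ : aeval θ (MonicCubic.poly fc.a fc.b fc.c) = 0) (h3 : finrank ℚ K = 3)
    (hF : fc.check = true) (hpr : fc.primeList.Forall Nat.Prime) (h : famCheck fc D f = true) :
    WithZero.log ((fc.W₂ hθ h3 hF hpr).valuation K ((lin hθ f.2.2.g.1 f.2.2.g.2.1 f.2.2.g.2.2 : 𝓞 K) : K)) =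
      famL₂ f := by
  have hq := fc.q_prime hpr
  have hk := (common_of_famCheck h).2.2.2
  unfold famKindCheck at hk
  unfold famL₂
  by_cases h1 : f.1 = 1
  · have h0 : ¬ f.1 = 0 := by omega
    rw [if_neg h0, if_pos h1, decide_eq_true_eq] at hk
    rw [if_pos h1, hk]
    simp only
    rw [lin_q hθ]
    have hN : (Algebra.norm ℤ ((fc.q : ℕ) : 𝓞 K)).natAbs = fc.q ^ 3 * 1 := by
      have e := natAbs_norm_lin_coords (fc.irreducible_of_check hF) hθ h3 ((fc.q : ℤ), 0, 0)
      simp only at e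
      rw [lin_q hθ] at e
      rw [e]
      simp [normFormZ, Int.natAbs_pow]
    have hm : ¬ fc.q ∣ 1 := fun hd => hq.one_lt.ne' (Nat.dvd_one.mp hd)
    exact (log_valuation_eq_neg_one_of_one_two hq (W₁_ne_W₂ hθ h3 hF hpr) (eq_W₁_or_W₂ hθ h3 hF hpr)
      (absNorm_W₁ hθ h3 hF hpr) (absNorm_W₂ hθ h3 hF hpr) (q_mem_W₁ hθ h3 hF hpr) (q_mem_W₂ hθ h3 hF hpr)
      hN hm).2
  rw [if_neg h1]
  have hval : (fc.W₂ hθ h3 hF hpr).valuation K ((lin hθ f.2.2.g.1 f.2.2.g.2.1 f.2.2.g.2.2 : 𝓞 K) : K) = 1 := by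
    split_ifs at hk with h0 h2 h3'
    · exact valuation_eq_one_of_unitCert hθ hk _
    · simp only [Bool.and_eq_true] at hk
      exact valuation_eq_one_of_invCert hθ _ (W₂_asIdeal hθ h3 hF hpr) hk.1.1.2
    · simp only [Bool.and_eq_true] at hk
      exact valuation_eq_one_of_invCert hθ _ (W₂_asIdeal hθ h3 hF hpr) hk.1.2
  rw [hval, WithZero.log_one]

/-! ## Kernel sanity checks (`M283`: `ε = −4 − α²`, `γ = 10 + α²` with `γ(36 + α − 6α²) = 19²`, the element `q = 19`) -/

example : famCheck m283 (23, -5, 7) (0, (0, 0, 0, 0), m283.fu) = true := by decide +kernel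

example : famCheck m283 (23, -5, 7) (3, (0, 0, 0, 0), m283.gam) = true := by decide +kernel

example : famCheck m283 (23, -5, 7) (1, (0, 0, 0, 0), ⟨(0, 0, 0), (19, 0, 0), false, (0, 0, 0), 0, 0, (0, 0, 0), []⟩) =
    true := by decide +kernel

end Summit.BirchSwinnertonDyer.BirchSwinnertonDyer.Rank2Observatory.TwoDescCl

end
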